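import Mathlib
import HarnessLib.Audit
import Summits.PneNP.PneNP.Theorems.PstarCrossCaseTEq
import Summits.PneNP.PneNP.Theorems.PstarNorUnitExcCore

/-!
# The blind free CROSS gate, regime T (node N3): the (EQ) chord has NO companion — the (EQ) row is CLOSED (O2 / E1; prover-1 g23)

FRONTIER range-avoidance ladder, rung F-N3 (`stmt-PneNP-19007`), cell `pnp-ideate`; restricted-model proof complexity — nothing here bears on `P` versus `NP`.

Node N3 (`PstarCrossNodes.CrossCaseT`), the (EQ) row `q_m = u_{e₁}` of `PstarCrossCaseTRows.caseT_row`.  A second real chord `e₂ ≠ e₁` has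
`u_{e₂} + u_{e₁} = μ₁μ₂` (`PstarCrossCaseTRows.caseT_eq_other`), i.e. `Q_{D e₂} = q + μ₁μ₂ + κ` for the quadratic `q := q_m + 1` whose polar form IS the
constraint's `polarDir m` and whose zero set `{u_{e₁} = 1}` lies in `{u_{e₂} = 1}`: this is an (EXC) relation in the sense of the clean theory, so
`PstarNorUnitExcCore.exc_unit_core` applies verbatim.  Its (EQ) alternative makes `D e₂ = D e₁` (`chord_eq_of_EQ`), impossible; its UNIT alternative gives
`D e₂ = {j₁, j₂}` with the linear parts of `μ₁, μ₂` supported on one literal `σ` of `j₁` and one `τ` of `j₂` and the polar formula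
`polar(Q_{D e₁}) = polar(Q_{D e₂}) + e_σ ∧ e_τ`.  Evaluating `u_{e₂} + u_{e₁} = μ₁μ₂` at `0, e_σ, e_τ, e_σ + e_τ` then forces `γ₁ = γ₂` and
`μ₁μ₂(e_σ + e_τ) = 1`, and one of the points `e_σ + e_τ`, `e_σ + e_τ + e_{σ'}` (`σ'` the mate of `σ`) lies in `{u_{e₁} = 1}` with `μ₁μ₂ = 1` — contradicting the
vanishing of `μ₁μ₂` there.

* `polarDir_eq_of_eq` — in the (EQ) case the constraint's polar form is `polar(Q_{D e₁})`;
* **`caseT_eq_no_other`** — the (EQ) chord is the only real chord;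
* **`crossCaseT_eq`** — hence (with `PstarCrossCaseTEq.crossCaseT_eq_single`) **regime T with an (EQ) row has `#J₀ ≤ 5`**: the (EQ) row of N3 is closed.
What remains of N3: the rows `q_m ≡ 0` and `q_m` a non-degenerate product (w.r.t. every real chord), see `PstarCrossCaseTRows.caseT_row`.
-/

set_option linter.dupNamespace false -- `Summit.PneNP.PneNP.…`: summit = sub-problem name (D-0017 single-conjunct layout)

open Finset Module Literature.Computability.Complexity
open Summit.PneNP.PneNP.Theorems.PstarTyped (Typed)
open Summit.PneNP.PneNP.Theorems.PstarSALevel (varSet BoundaryExpanding SimpleOverlap)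
open Summit.PneNP.PneNP.Theorems.PstarGapLinearised (andPair)
open Summit.PneNP.PneNP.Theorems.PstarChordEndgameTools (mem_andPair_iff)
open Summit.PneNP.PneNP.Theorems.PstarCubeIdeals (IsAffineFn IsQuadFn)
open Summit.PneNP.PneNP.Theorems.PstarProductRank (qform polar)
open Summit.PneNP.PneNP.Theorems.PstarPathRank (AndAdj polar_basis and_ne)
open Summit.PneNP.PneNP.Theorems.PstarReadSumset (V2)
open Summit.PneNP.PneNP.Theorems.PstarForcing (polar_unique)
open Summit.PneNP.PneNP.Theorems.PstarChordSystem (ChordSystem)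
open Summit.PneNP.PneNP.Theorems.PstarChordBridgeTools
open Summit.PneNP.PneNP.Theorems.PstarChordBridge
open Summit.PneNP.PneNP.Theorems.PstarChordBridgeForcing (freeMon gam sys_u_eq qform_add' chord_eq_of_EQ)
open Summit.PneNP.PneNP.Theorems.PstarChordBridgeBasis (qDir polarDir)
open Summit.PneNP.PneNP.Theorems.PstarChordBridgeCorner (qDir_add)
open Summit.PneNP.PneNP.Theorems.PstarCrossData (CrossData)
open Summit.PneNP.PneNP.Theorems.PstarCrossSystem
open Summit.PneNP.PneNP.Theorems.PstarCrossCaseT (forcing_of_real)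
open Summit.PneNP.PneNP.Theorems.PstarCrossCaseU2 (u_add)
open Summit.PneNP.PneNP.Theorems.PstarCrossCaseTRows (caseT_eq_other)
open Summit.PneNP.PneNP.Theorems.PstarCrossCaseTEq (crossCaseT_eq_single)
open Summit.PneNP.PneNP.Theorems.PstarNorUnitExcCore (exc_unit_core)

namespace Summit.PneNP.PneNP.Theorems.PstarCrossCaseTEqUnique

variable {n m : ℕ}

section

variable (I : LocalMap 4 n m) {r : ℕ} {B : BridgeData n m} {e_p e_q g₀ : Fin m}

/-- **In the (EQ) case the constraint's polar form is `polar(Q_{D e₁})`.** -/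
theorem polarDir_eq_of_eq {mv : V2} {e₁ : Fin m} (hq : ∀ x, qDir I B mv x = (sys I B).u e₁ x) :
    polarDir I B mv = polar (B.D e₁) (fun j => I.vars j 2) (fun j => I.vars j 3) := by
  refine polar_unique (Q := qDir I B mv) (qDir_add I B mv) fun x w => ?_
  rw [hq, hq, hq, hq]
  exact u_add I B e₁ x w

/-- **The (EQ) chord is the only real chord of regime T.**  See the module docstring. -/
theorem caseT_eq_no_other (hI : I.IsPure xorAndPred) (hT : Typed I) (hS : SimpleOverlap I) (hB : BoundaryExpanding r I)
    (hD : CrossData I r B e_p e_q g₀) {mv : V2} (hmvT : mv = (0, 1) ∨ mv = (1, 1))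
    (hline : ∀ e ∈ (B.N.erase e_q).erase e_p,
      (((sys I B).vsys e_p e_q).ρ e 0 = 0 ∨ ((sys I B).vsys e_p e_q).ρ e 0 = mv) ∧
      (((sys I B).vsys e_p e_q).ρ' e 0 = 0 ∨ ((sys I B).vsys e_p e_q).ρ' e 0 = mv))
    (hread : ∀ e ∈ (B.N.erase e_q).erase e_p, ((sys I B).vsys e_p e_q).ρ e 0 ≠ 0 ∨ ((sys I B).vsys e_p e_q).ρ' e 0 ≠ 0)
    {e₁ : Fin m} (he₁ : e₁ ∈ (B.N.erase e_q).erase e_p) (hq : ∀ x, qDir I B mv x = (sys I B).u e₁ x)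
    {e₂ : Fin m} (he₂ : e₂ ∈ (B.N.erase e_q).erase e_p) (hne : e₂ ≠ e₁) : False := by
  classical
  have hW := hD.wf
  have he₁N : e₁ ∈ B.N := mem_of_mem_erase (mem_of_mem_erase he₁)
  have he₂N : e₂ ∈ B.N := mem_of_mem_erase (mem_of_mem_erase he₂)
  have he₂J : e₂ ∈ B.J₀ := hW.hN he₂N
  obtain ⟨μ₁, μ₂, h₁, h₂, -, -, -, hP⟩ := caseT_eq_other I hI hT hS hB hD hmvT hline hread he₁N hq he₂ hne
  have e01 : ∀ t : ZMod 2, t = 0 ∨ t = 1 := by decide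
  -- where `u_{e₁} = 1`, also `u_{e₂} = 1`
  have hu₂ : ∀ x, (sys I B).u e₁ x = 1 → (sys I B).u e₂ x = 1 := fun x hx => by
    rcases e01 ((sys I B).u e₂ x) with h0 | h1
    · have h := (forcing_of_real I hI hT hD hmvT hline hread he₂ h0).2
      rw [hq x, hx] at h
      exact absurd h one_ne_zero
    · exact h1
  -- the (EXC) data for `exc_unit_core` with `q := q_m + 1`
  set q : (Fin n → ZMod 2) → ZMod 2 := fun x => qDir I B mv x + 1 with hqdef
  have hqB : ∀ x w, q (x + w) = q x + q w + q 0 + polarDir I B mv x w := fun x w => by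
    simp only [hqdef]
    rw [qDir_add I B mv x w]
    generalize qDir I B mv x = a; generalize qDir I B mv w = b; generalize qDir I B mv 0 = c
    generalize polarDir I B mv x w = d
    revert a b c d; decide
  have hZ : ∀ x, q x = 0 → qform (B.D e₂) (fun j => I.vars j 2) (fun j => I.vars j 3) x = 1 + gam B e₂ := fun x hx => by
    have hx1 : (sys I B).u e₁ x = 1 := by
      rw [← hq x]
      have e : ∀ a : ZMod 2, a + 1 = 0 → a = 1 := by decide
      exact e _ hx
    have h := hu₂ x hx1
    rw [sys_u_eq] at h
    have e : ∀ g Q : ZMod 2, g + Q = 1 → Q = 1 + g := by decide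
    exact e _ _ h
  have hEXC : ∀ x, qform (B.D e₂) (fun j => I.vars j 2) (fun j => I.vars j 3) x = q x + μ₁ x * μ₂ x + (1 + gam B e₂) := fun x => by
    have h := hP x
    rw [← hq x, sys_u_eq] at h
    simp only [hqdef]
    have e : ∀ g₂ Q₂ qq P : ZMod 2, g₂ + Q₂ + qq = P → Q₂ = qq + 1 + P + (1 + g₂) := by decide
    exact e _ _ _ _ h
  have hr : (B.J₀ ∪ B.G₁ ∪ B.G₂).card ≤ r := by
    refine le_trans (card_le_card ?_) hD.rad
    exact union_subset_union (union_subset_union subset_rfl (subset_insert g₀ B.G₁)) subset_rfl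
  have hd₁ : Disjoint B.G₁ B.J₀ := Finset.disjoint_of_subset_left (subset_insert g₀ B.G₁) hD.disj₁
  have heG : e₂ ∉ B.G₁ ∪ B.G₂ := by
    rw [mem_union, not_or]
    exact ⟨fun h => Finset.disjoint_left.1 hd₁ h he₂J, fun h => Finset.disjoint_left.1 hD.disj₂ h he₂J⟩
  rcases exc_unit_core I hI hS hB hW hr he₂N heG mv hqB hZ h₁ h₂ hEXC with ⟨κ', hEQ⟩ | ⟨j₁, j₂, σ, τ, hj12, hDe₂, hdisj, hσ, hτ, hsupp, hpolar, -⟩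
  · -- (EQ) for `e₂` against `q`: `D e₂ = D e₁`, so `e₂ = e₁`
    refine hne (chord_eq_of_EQ I hI hS hW (q := qform (B.D e₁) (fun j => I.vars j 2) (fun j => I.vars j 3)) he₂N he₁N
      (κ := κ' + 1 + gam B e₁) (κ' := 0) (fun x => ?_) (fun x => by rw [add_zero]))
    rw [hEQ x]
    simp only [hqdef]
    rw [hq x, sys_u_eq]
    have e : ∀ g a k : ZMod 2, g + a + 1 + k = a + (k + 1 + g) := by decide
    exact e _ _ _
  · -- UNIT: `D e₂ = {j₁, j₂}`, supports `{σ, τ}`, polar formula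
    have hpol₁ := polarDir_eq_of_eq I hq
    -- indicator identities on basis vectors
    have hAdj : ∀ v w : Fin n, (if AndAdj I (B.D e₁) v w then (1 : ZMod 2) else 0) =
        (if AndAdj I (B.D e₂) v w then 1 else 0) + (if (v = σ ∧ w = τ) ∨ (v = τ ∧ w = σ) then 1 else 0) := fun v w => by
      have h := hpolar v w
      rw [hpol₁, polar_basis I hI hS] at h
      exact h
    -- the mate `σ'` of `σ` in `j₁`
    obtain ⟨σ', hσ'j, hσσ'⟩ : ∃ σ' : Fin n, σ' ∈ andPair I j₁ ∧ σ' ≠ σ := by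
      rcases (mem_andPair_iff I j₁ σ).1 hσ with h | h
      · exact ⟨I.vars j₁ 3, (mem_andPair_iff I j₁ _).2 (Or.inr rfl), fun e => and_ne I hI j₁ (h.symm.trans e.symm)⟩
      · exact ⟨I.vars j₁ 2, (mem_andPair_iff I j₁ _).2 (Or.inl rfl), fun e => and_ne I hI j₁ (e.trans h)⟩
    have hτσ : τ ≠ σ := fun h => Finset.disjoint_left.1 hdisj hσ (h ▸ hτ)
    have hτσ' : τ ≠ σ' := fun h => Finset.disjoint_left.1 hdisj hσ'j (h ▸ hτ)
    -- `AndAdj (D e₂) v w` for `D e₂ = {j₁, j₂}`: only the two pairs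
    have hAdj₂ : ∀ v w : Fin n, AndAdj I (B.D e₂) v w → (v ∈ andPair I j₁ ∧ w ∈ andPair I j₁) ∨ (v ∈ andPair I j₂ ∧ w ∈ andPair I j₂) := by
      rintro v w ⟨j, hj, hvw⟩
      rw [hDe₂, mem_insert, mem_singleton] at hj
      rcases hj with rfl | rfl
      · left
        rcases hvw with ⟨a, b⟩ | ⟨a, b⟩
        · exact ⟨(mem_andPair_iff I _ _).2 (Or.inl a.symm), (mem_andPair_iff I _ _).2 (Or.inr b.symm)⟩
        · exact ⟨(mem_andPair_iff I _ _).2 (Or.inr b.symm), (mem_andPair_iff I _ _).2 (Or.inl a.symm)⟩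
      · right
        rcases hvw with ⟨a, b⟩ | ⟨a, b⟩
        · exact ⟨(mem_andPair_iff I _ _).2 (Or.inl a.symm), (mem_andPair_iff I _ _).2 (Or.inr b.symm)⟩
        · exact ⟨(mem_andPair_iff I _ _).2 (Or.inr b.symm), (mem_andPair_iff I _ _).2 (Or.inl a.symm)⟩
    have hστ₂ : ¬ AndAdj I (B.D e₂) σ τ := fun h => by
      rcases hAdj₂ σ τ h with ⟨-, hτ₁⟩ | ⟨hσ₂, -⟩
      · exact Finset.disjoint_left.1 hdisj hτ₁ hτ
      · exact Finset.disjoint_left.1 hdisj hσ hσ₂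
    have hτσ'₂ : ¬ AndAdj I (B.D e₂) τ σ' := fun h => by
      rcases hAdj₂ τ σ' h with ⟨hτ₁, -⟩ | ⟨-, hσ'₂⟩
      · exact Finset.disjoint_left.1 hdisj hτ₁ hτ
      · exact Finset.disjoint_left.1 hdisj hσ'j hσ'₂
    have hσσ'₂ : AndAdj I (B.D e₂) σ σ' := by
      refine ⟨j₁, by rw [hDe₂]; exact mem_insert_self _ _, ?_⟩
      rcases (mem_andPair_iff I j₁ σ).1 hσ with a | a <;> rcases (mem_andPair_iff I j₁ σ').1 hσ'j with b | b
      · exact absurd (b.trans a.symm) hσσ'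
      · exact Or.inl ⟨a.symm, b.symm⟩
      · exact Or.inr ⟨b.symm, a.symm⟩
      · exact absurd (b.trans a.symm) hσσ'
    -- the three polar values of `D e₁` we need
    have hP₁στ : polar (K := ZMod 2) (B.D e₁) (fun j => I.vars j 2) (fun j => I.vars j 3) (Pi.single σ 1) (Pi.single τ 1) = 1 := by
      rw [polar_basis I hI hS, hAdj, if_neg hστ₂, if_pos (Or.inl ⟨rfl, rfl⟩), zero_add]
    have hP₁σσ' : polar (K := ZMod 2) (B.D e₁) (fun j => I.vars j 2) (fun j => I.vars j 3) (Pi.single σ 1) (Pi.single σ' 1) = 1 := by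
      rw [polar_basis I hI hS, hAdj, if_pos hσσ'₂, if_neg, add_zero]
      rintro (⟨-, h⟩ | ⟨h, -⟩)
      · exact hτσ' h.symm
      · exact hτσ h.symm
    have hP₁τσ' : polar (K := ZMod 2) (B.D e₁) (fun j => I.vars j 2) (fun j => I.vars j 3) (Pi.single τ 1) (Pi.single σ' 1) = 0 := by
      rw [polar_basis I hI hS, hAdj, if_neg hτσ'₂, if_neg, add_zero]
      rintro (⟨h, -⟩ | ⟨-, h⟩)
      · exact hτσ h
      · exact hσσ' h
    have hP₂στ : polar (K := ZMod 2) (B.D e₂) (fun j => I.vars j 2) (fun j => I.vars j 3) (Pi.single σ 1) (Pi.single τ 1) = 0 := by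
      rw [polar_basis I hI hS, if_neg hστ₂]
    -- values of `u₁`, `u₂` at `0`, `e_σ`, `e_τ`, `e_σ + e_τ`, `e_σ + e_τ + e_σ'`
    have hu0 : ∀ e, (sys I B).u e 0 = gam B e := fun e => by rw [sys_u_eq, PstarChordBridgeFlat.qform_zero, add_zero]
    have hu1 : ∀ e (v : Fin n), (sys I B).u e (Pi.single v 1) = gam B e := fun e v => by
      rw [sys_u_eq, PstarChordBridgeFlat.qform_single I hI, add_zero]
    have hu₁στ : (sys I B).u e₁ (Pi.single σ 1 + Pi.single τ 1) = gam B e₁ + 1 := by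
      rw [u_add I B e₁, hu1, hu1, hu0, hP₁στ]
      generalize gam B e₁ = g; revert g; decide
    have hu₂στ : (sys I B).u e₂ (Pi.single σ 1 + Pi.single τ 1) = gam B e₂ := by
      rw [u_add I B e₂, hu1, hu1, hu0, hP₂στ]
      generalize gam B e₂ = g; revert g; decide
    have hu₁στσ' : (sys I B).u e₁ (Pi.single σ 1 + Pi.single τ 1 + Pi.single σ' 1) = gam B e₁ := by
      rw [u_add I B e₁, hu₁στ, hu1, hu0, map_add, LinearMap.add_apply, hP₁σσ', hP₁τσ']
      generalize gam B e₁ = g; revert g; decide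
    -- the linear parts are supported on `{σ, τ}`: `σ'` is invisible
    have hσ'off : μ₁ (Pi.single σ' 1) = μ₁ 0 ∧ μ₂ (Pi.single σ' 1) = μ₂ 0 := by
      by_contra h
      rw [not_and_or] at h
      rcases (hsupp σ').1 h with e | e
      · exact hσσ' e
      · exact hτσ'.symm e
    -- the product at the five points
    have hPt0 := hP 0
    have hPtσ := hP (Pi.single σ 1)
    have hPtτ := hP (Pi.single τ 1)
    have hPtστ := hP (Pi.single σ 1 + Pi.single τ 1)
    have hPtστσ' := hP (Pi.single σ 1 + Pi.single τ 1 + Pi.single σ' 1)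
    rw [hu0, hu0] at hPt0
    rw [hu1, hu1] at hPtσ hPtτ
    rw [hu₂στ, hu₁στ, h₁ (Pi.single σ 1) (Pi.single τ 1), h₂ (Pi.single σ 1) (Pi.single τ 1)] at hPtστ
    have hu₂στσ' : (sys I B).u e₂ (Pi.single σ 1 + Pi.single τ 1 + Pi.single σ' 1) + (sys I B).u e₁ (Pi.single σ 1 + Pi.single τ 1 + Pi.single σ' 1) =
        μ₁ (Pi.single σ 1 + Pi.single τ 1) * μ₂ (Pi.single σ 1 + Pi.single τ 1) := by
      rw [hPtστσ', h₁ (Pi.single σ 1 + Pi.single τ 1) (Pi.single σ' 1), h₂ (Pi.single σ 1 + Pi.single τ 1) (Pi.single σ' 1), hσ'off.1, hσ'off.2,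
        h₁ (Pi.single σ 1) (Pi.single τ 1), h₂ (Pi.single σ 1) (Pi.single τ 1)]
      generalize μ₁ (Pi.single σ 1) = a; generalize μ₁ (Pi.single τ 1) = b; generalize μ₁ 0 = c
      generalize μ₂ (Pi.single σ 1) = a'; generalize μ₂ (Pi.single τ 1) = b'; generalize μ₂ 0 = c'
      revert a b c a' b' c'; decide
    -- where `u_{e₁} = 1` the product vanishes; combine the five evaluations
    have hvan : ∀ x, (sys I B).u e₁ x = 1 → μ₁ x * μ₂ x = 0 := fun x hx => by rw [← hP x, hu₂ x hx, hx]; decide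
    rcases e01 (gam B e₁) with g0 | g1
    · -- `γ₁ = 0`: the point `e_σ + e_τ` has `u₁ = 1`
      have hz := hvan (Pi.single σ 1 + Pi.single τ 1) (by rw [hu₁στ, g0]; decide)
      rw [h₁ (Pi.single σ 1) (Pi.single τ 1), h₂ (Pi.single σ 1) (Pi.single τ 1)] at hz
      rw [g0] at hPt0 hPtσ hPtτ hPtστ
      revert hPt0 hPtσ hPtτ hPtστ hz
      generalize μ₁ (Pi.single σ 1) = a; generalize μ₁ (Pi.single τ 1) = b; generalize μ₁ 0 = c
      generalize μ₂ (Pi.single σ 1) = a'; generalize μ₂ (Pi.single τ 1) = b'; generalize μ₂ 0 = c'; generalize gam B e₂ = g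
      revert a b c a' b' c' g; decide
    · -- `γ₁ = 1`: the point `e_σ + e_τ + e_σ'` has `u₁ = 1`
      have hz := hvan (Pi.single σ 1 + Pi.single τ 1 + Pi.single σ' 1) (by rw [hu₁στσ', g1])
      have hz' : μ₁ (Pi.single σ 1 + Pi.single τ 1) * μ₂ (Pi.single σ 1 + Pi.single τ 1) = 0 := by
        rw [← hu₂στσ', hu₁στσ', g1]
        have h := hu₂ _ (by rw [hu₁στσ', g1] : (sys I B).u e₁ (Pi.single σ 1 + Pi.single τ 1 + Pi.single σ' 1) = 1)
        rw [h]; decide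
      rw [h₁ (Pi.single σ 1) (Pi.single τ 1), h₂ (Pi.single σ 1) (Pi.single τ 1)] at hz'
      rw [g1] at hPt0 hPtσ hPtτ hPtστ
      clear hz
      revert hPt0 hPtσ hPtτ hPtστ hz'
      generalize μ₁ (Pi.single σ 1) = a; generalize μ₁ (Pi.single τ 1) = b; generalize μ₁ 0 = c
      generalize μ₂ (Pi.single σ 1) = a'; generalize μ₂ (Pi.single τ 1) = b'; generalize μ₂ 0 = c'; generalize gam B e₂ = g
      revert a b c a' b' c' g; decide

end

/-- **Regime T with an (EQ) row has at most five core outputs** — the (EQ) row of node N3 is closed. -/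
theorem crossCaseT_eq (I : LocalMap 4 n m) {r : ℕ} {B : BridgeData n m} {e_p e_q g₀ : Fin m}
    (hI : I.IsPure xorAndPred) (hT : Typed I) (hS : SimpleOverlap I) (hB : BoundaryExpanding r I)
    (hD : CrossData I r B e_p e_q g₀) {mv : V2} (hmvT : mv = (0, 1) ∨ mv = (1, 1))
    (hline : ∀ e ∈ (B.N.erase e_q).erase e_p,
      (((sys I B).vsys e_p e_q).ρ e 0 = 0 ∨ ((sys I B).vsys e_p e_q).ρ e 0 = mv) ∧
      (((sys I B).vsys e_p e_q).ρ' e 0 = 0 ∨ ((sys I B).vsys e_p e_q).ρ' e 0 = mv))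
    (hread : ∀ e ∈ (B.N.erase e_q).erase e_p, ((sys I B).vsys e_p e_q).ρ e 0 ≠ 0 ∨ ((sys I B).vsys e_p e_q).ρ' e 0 ≠ 0)
    {e₁ : Fin m} (he₁ : e₁ ∈ (B.N.erase e_q).erase e_p) (hq : ∀ x, qDir I B mv x = (sys I B).u e₁ x) : B.J₀.card ≤ 5 := by
  have hsingle : (B.N.erase e_q).erase e_p = {e₁} :=
    eq_singleton_iff_unique_mem.2 ⟨he₁, fun e he => by
      by_contra hne
      exact caseT_eq_no_other I hI hT hS hB hD hmvT hline hread he₁ hq he hne⟩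
  exact crossCaseT_eq_single I hI hT hS hB hD hmvT hline hread hsingle hq

end Summit.PneNP.PneNP.Theorems.PstarCrossCaseTEqUnique
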